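import Summits.BirchSwinnertonDyer.BirchSwinnertonDyer.Theorems.CycTangentCMCycTangentBoundPairSupply
import Literature.NumberTheory.GaloisRepresentations.EverywhereUnramifiedAlgebraicHeckeCharacter
import Literature.NumberTheory.GaloisRepresentations.CMTypeHeckeCharacter
import Literature.NumberTheory.EllipticCurves.HeegnerPointsImaginaryQuadraticProofs
import Literature.NumberTheory.GaloisRepresentations.AbsGaloisOuterConj
import Literature.NumberTheory.GaloisRepresentations.HeckeCharacterBaseChangeGaloisConjProofs
import Literature.NumberTheory.EllipticCurves.IwasawaSelmerIsTorsionProofs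
import Literature.NumberTheory.EllipticCurves.IwasawaAlgebraPseudoIsomorphicProofs
import Literature.NumberTheory.EllipticCurves.BurungaleSkinnerTianWan2024.GreenbergMainStatementOPEN
import Literature.NumberTheory.EllipticCurves.DeShalit1987.KatzMeasureUnitTwistPair
import Summits.BirchSwinnertonDyer.BirchSwinnertonDyer.Theorems.PrintCf2RubinValueTwoValueRigidityOfCharIdeal
import Summits.BirchSwinnertonDyer.BirchSwinnertonDyer.Theorems.PrintCf2RubinValueTwoKatzPeriodRigidityFull
import Summits.BirchSwinnertonDyer.BirchSwinnertonDyer.Theorems.PrintCf2RubinValueTwoRubinValueFormulaAtTwoUniqueTransport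
import Literature.NumberTheory.EllipticCurves.IntSeriesNodeTransport
import Literature.NumberTheory.EllipticCurves.IntSeriesTorsionNodeRigidity
import Literature.NumberTheory.EllipticCurves.IntSeriesOnePlusPowMul
import HarnessLib

/-!
# `SplitsliceSupply` v1.4 — crux `TwoVariableEulerSystemDivisibility` (stmt-BirchSwinnertonDyer-20728), route
`SignedBaseChange`, line of record `Lines/ratlift.lean` v5.4 (sha16 `0bd9dcd5125037c5`, 130 315 B — UNTOUCHED);
companion of `SplitsliceFam.lean` v1.9 (`15642d3b8a3c`) §F13 decl 25 `rich_of_two_characters` and of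
`SplitsliceSeams.lean` v1.1 (`f1fb557a1c8b`) S42 `valueConditions_of_adaptedPair`; annex `Lines/ratlift_annex_g45.md` rev 6 §9.

WHAT THIS FILE IS. Input (I) of the frame PIN (vi-a) of annex g45 §9 — the EXISTENCE of the two-character datum
`(A, B, rA, rB, a₁, a₂, b₁, b₂)` consumed by `rich_of_two_characters` (Fam decl 25) and `valueConditions_of_adaptedPair`
(Seams S42) — DISCHARGED IN KERNEL for every imaginary quadratic `K`, every prime `p`, every `ι : ℚ̄_p ≃ ℂ` and
EVERY generator pair `(κ₁, κ₂; γ₁, γ₂)` of `Γ_K` (`exists_adaptedPair`, `exists_adaptedPair_absGaloisQuot`):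
everywhere-unramified Hecke characters `A` of infinity type `(−a₁, a₂)` with `a₁ ≠ a₂` and `B` of type `(−b₁, b₂)` with
`b₁, b₂ ≥ 1`, `p`-adic avatars `rA`, `rB` (`IsPAdicAvatarOf ι`) factoring through the pair (`FactorsThroughPair κ₁ κ₂`),
AND the Hecke identity `(B ∘ c)·B = 1` (`c` = complex conjugation of the CM field `K`; equivalently `(B ∘ ρ̄)·B = 1` for
any `ρ ∈ Γ_ℚ ∖ res Γ_K`). It is an ASSEMBLY over two tree producers and `galConj` algebra — no new mathematics:
* (r1) `HeckeCharacter.exists_hasInfinityType_classNumber_mul_torsionOrder_unramified`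
  (Literature/…/EverywhereUnramifiedAlgebraicHeckeCharacter.lean :190): an everywhere-unramified `Ψ` of type `(h_K·w_K, 0)`;
* (r2) `Theorems.CycTangentCMCycTangentBoundPairSupply.exists_isPAdicAvatarOf_pow_factorsThroughPair` (:107, landed p584708):
  for `Ψ` algebraic and unramified outside `p` and ANY generator pair, `∃ M > 0` and a continuous `χ` with `e ∘ χⁿ` the
  avatar of `Ψ^{Mn}` through the pair — applied SEPARATELY (independent exponents, critic V#26dq n4) to `Ψ⁻¹` and to
  `Φ := (Ψ ∘ c)·Ψ⁻¹`;
* the witness: `A := (Ψ⁻¹)^{M_A}` of type `(−M_A h_K w_K, 0)`, `B := Φ^{M_B}` of type `(−M_B h_K w_K, M_B h_K w_K)`;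
  `(B ∘ c)·B = ((Φ ∘ c)·Φ)^{M_B} = (Ψ·(Ψ∘c)⁻¹·(Ψ∘c)·Ψ⁻¹)^{M_B} = 1` by `galConj_mul`/`galConj_inv`/`galConj_galConj`/`galConj_one`
  and `c² = 1` (`galConj_mul_self_eq_one_of_witness`).
Also: `exists_not_mem_range_absGaloisRestrict'` (a `ρ ∈ Γ_ℚ ∖ res Γ_K` exists for `K` imaginary quadratic) and the
Literature-only re-derivations `absGaloisQuot_eq_complexConj'`, `galConj_absGaloisQuot_eq'` (as in Seams S36/S37; the
Theorems-side originals `UniversalToricDescentThinCombReflectedAvatar` :212/:235 are cited, not imported).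

CONSUMER (Theorems side / critic's junction probe; a Cruxes file cannot import another on the farm):
`haveI := isGalois_of_isImaginaryQuadratic hK` (Seams S35);
`obtain ⟨ρ, hρ⟩ := exists_not_mem_range_absGaloisRestrict' hK`;
`obtain ⟨A, B, rA, rB, a₁, a₂, b₁, b₂, hrA, hrB, hκA, hκB, hunrA, hunrB, hab, hb₁, hb₂, htA, htB, hBc⟩ :=
   exists_adaptedPair_absGaloisQuot ι hK Fact.out ρ hρ`;
`obtain ⟨hB₁, hA₁, hB₂⟩ := valueConditions_of_adaptedPair hK hp2 hrA hrB hκA hκB hunrA hunrB hab hb₂ htA htB hκ₁ hκ₂ Fact.out ρ hρ hBc`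
(Seams S42); then `rich_of_two_characters A B rA rB hrA hrB hκA hκB hunrA hunrB a₁ a₂ b₁ b₂ hb₁ hb₂ htA htB
(frameAuxGrid_of_facts hJ hpin hK hf.1 hH A B hunrA hunrB a₁ a₂ b₁ b₂ hb₁ hb₂ htA htB) hB₁ hA₁ hB₂` (Fam decl 25 with Seams S13)
feeds Fam decl 12. NET for (vi-a) after this file: (I) = ∅ and (II) = ∅ (kernel); what remains of the frame PIN is (III′) =
the named PUBLISHED fact `jacquet1972_functionalEquation_rankinSelbergHecke_cone` (binder `hJ`) + the LEVEL PIN `hpin`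
(Miyake 2006 Thm. 4.8.2 = Köhler 2011 Thm. 5.1; Literature typing debt).

§4 FIBRE SUPPLY (v1.1–v1.2, NEW; pure module algebra over arbitrary commutative rings `R →+* S`): the per-line MODULE data
`(F n, φ n, hφ n, hφk n)` of the doors `SplitsliceFam` decls 9/10/12 — an `S`-module, a `θ_n`-SEMILINEAR SURJECTION from
`M = Λ^ur'_2 ⊗_{Λ₂} X_Gr,2` with kernel `≤ (ker θ_n)·M` — are NOT arithmetic input: for any ring map `θ` with a ring SECTION
`ς` (for `θ_n = curveFam … n` the section is `PowerSeries.C`, by `SplitsliceFam.outerChar_C`) the coinvariant module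
`Fibre θ M := M ⧸ (ker θ)·M` with the `ς`-structure `fibreModuleOfSection` and the quotient map `fibreMap` (semilinear,
onto, kernel exactly `(ker θ)·M`: `fibreMap_surjective`, `fibreMap_eq_zero_iff`) SUPPLY them, and conversely ANY such datum
is canonically `S`-isomorphic to the fibre (`fibreEquivOfControl`, universal property `fibreLift`), so it has the fibre's
characteristic ideal and pseudo-isomorphism class (`charIdeal_fibre_eq_of_control`, `arePseudoIsomorphic_fibre_of_control`, v1.2,
by the tree's `Module.charIdeal_eq_of_linearEquiv` / `ArePseudoIsomorphic.of_linearEquiv` / `.trans`). Hence the arithmetic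
content of the doors' input (iv) is EXACTLY: CTRL_ℓ = a pseudo-isomorphism `Fibre θ_n M ∼ X n` (binder `hX`) and the
divisibility `p^t · θ_n(g) ∈ char_S(X n)` i.o. (binder `h`) — equivalently the ONE membership
`p^t · θ_n(g) ∈ char_{W⟦T⟧}(M ⧸ (ker θ_n)·M)` for infinitely many `n` (junction (J3) of annex g46 §2).

§5 FRAME TRANSPORT (v1.3, NEW; the (vi-b) SPLIT of annex g46 rev 2 §7): the doors' binder `hG₀` — ONE
`unrIntegers p`-rational-up-to-unit member `u · map (map J₀) g` of the Greenberg value frame over the crux's Katz series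
`LK` — follows from (vi-b₁) a RATIONAL member `map (map J₀) g` of the frame over the PRINTED Katz series `LK₀` (print:
BSTW24 Thm. 4.19 / §6.4 `𝓛_p^Gr(g/L) ∈ Λ_{L,𝒪_λ^ur}`, Katz 1978 / de Shalit 1987 II.4.14 `𝓛_v(K) ∈ Λ^ur`; a Literature
typing debt — the tree's `thm617_exists_commonKatzFrame_…_PRE` omits the rationality clause) and (vi-b₂) a TRANSPORT series
`V` relating `LK` to `LK₀` on the line `T₁ = 0` the frame reads (`isGreenbergLFunctionAnyRoot₂_mul_of_transport`,
kernel: values exist and multiply on the open bidisc — tree `PrintCf2.KatzMeasureValue.exists_hasValueAt₂_of_norm_lt_one`,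
`PrintCf2.RubinValueTwoReadout.hasValueAt₂_mul`, `norm_avatarValueAt_sub_one_lt_of_factorsThroughPair`); in the case
`LK = LK₀` (KATZ RIGIDITY across period data, annex g46 §7 — this seat's claim with proof sketch, NOT in print) `V = 1`
(`transport_one_of_eq`) and the doors run with `u = 1`.

§6 PERIOD TRANSPORT (v1.4, NEW; (J6)): the transport datum of §5 is DISCHARGED by the TREE's two-variable Katz period
rigidity `PrintCf2.KatzPeriodRigidity.exists_eq_unit_binomPow₂_mul` (de Shalit 1987 II.4.12 Remarks (iii)–(iv); applied with
`λ = 1`, `a = b = 0`, at the generator pair `(κᵢ.unitTwist (−1); γᵢ⁻¹)` via `PrintCf2.KatzUniqueTransport`): two inhabited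
typed Katz frames `IsKatzMeasure₂ ι v v̄ ∅ κ₁ κ₂ γ₁⁻¹ γ₂⁻¹ 1` at ANY two period triples (six non-zero quantities,
`LK₀ ≠ 0`) satisfy `LK = c₀·(1+T₁)^x(1+T₂)^w·LK₀`, whence the explicit unit transport series
`V = C (C c₀ · binomPow w · binomPow w)` (`exists_transport_of_isKatzMeasure₂`; `((1+y)²)^w = ((1+y)^w)²`,
`onePlusPow_mul_base`). NET for the doors: the binder `hG₀` costs (vi-b₁) ONLY (a `Λ^ur`-rational Katz/Greenberg pair
at print's periods with `LK₀ ≠ 0` — print), given the crux's own Katz frame.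

NO `sorry`, NO `def … : Prop`; imports = twelve Literature modules + FOUR Summits/Theorems modules (the (r2) producer
`CycTangentCMCycTangentBoundPairSupply`; `PrintCf2RubinValueTwoValueRigidityOfCharIdeal` for `hasValueAt₂_mul` /
`exists_hasValueAt₂_of_norm_lt_one`, §5; `PrintCf2RubinValueTwoKatzPeriodRigidityFull` + `…RubinValueFormulaAtTwoUniqueTransport`
for the period rigidity and the unit-twist invariance of the frame, §6).
NOT CLAIMED: anything arithmetic about `X_Gr,2`, Katz's `LK` or Greenberg's `G`; the value conditions (Seams), the grid
(Fam), the level pin, the analytic facts; `stub_ratEulerSystemSS`, the crux, its sibling 20727, the route and BSD are NOT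
proved. No stub of `Lines/ratlift.lean` is touched; nothing is registered.

References: [deShalit1987] II.1.4 Lemma (ii), II.4.17 (54); [NeukirchANT1999] VII (6.14); [Weil1956] §1–§2;
[Washington1997] §13.1, Thm. 13.4; [SerreAbelianLadic1968] Ch. II §2.4; [CastellaHsieh2018] §3.3.
-/

noncomputable section
set_option linter.dupNamespace false
set_option autoImplicit false

open scoped NumberField Topology
open NumberField IsDedekindDomain Field
open Literature.NumberTheory.GaloisRepresentations
open Literature.NumberTheory.EllipticCurves

namespace Summit.BirchSwinnertonDyer.BirchSwinnertonDyer.Cruxes.TwoVariableEulerSystemDivisibility.SplitsliceSupply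

/-! ### §1. `galConj` algebra: the Hecke identity of the anticyclotomic witness -/

section GalConjAlgebra

variable {F₀ K : Type} [Field F₀] [Field K] [NumberField K] [Algebra F₀ K]

/-- `galConj σ` commutes with natural powers (it is multiplicative, `galConj_mul`). [folklore] -/
theorem galConj_pow' (σ : K ≃ₐ[F₀] K) (χ : HeckeCharacter K) (n : ℕ) :
    HeckeCharacter.galConj σ (χ ^ n) = HeckeCharacter.galConj σ χ ^ n := by
  induction n with
  | zero =>
    rw [pow_zero, pow_zero]
    ext x
    rfl
  | succ n ih => rw [pow_succ, HeckeCharacter.galConj_mul, ih, pow_succ]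

/-- For an involution `σ` (`σ * σ = 1`): `(χ ∘ σ) ∘ σ = χ`. [folklore] -/
theorem galConj_galConj_of_mul_self_eq_one {σ : K ≃ₐ[F₀] K} (hσ : σ * σ = 1) (χ : HeckeCharacter K) :
    HeckeCharacter.galConj σ (HeckeCharacter.galConj σ χ) = χ := by
  rw [HeckeCharacter.galConj_galConj, hσ, HeckeCharacter.galConj_one]

/-- **The Hecke identity of the anticyclotomic witness.** For an involution `σ` of `K` and ANY Hecke character `Ψ`,
the character `Φ := (Ψ ∘ σ)·Ψ⁻¹` and all its powers `B := Φ^M` satisfy `(B ∘ σ)·B = 1`: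
`(Φ ∘ σ)·Φ = Ψ·(Ψ ∘ σ)⁻¹·(Ψ ∘ σ)·Ψ⁻¹ = 1`. [folklore] -/
theorem galConj_mul_self_eq_one_of_witness {σ : K ≃ₐ[F₀] K} (hσ : σ * σ = 1) (Ψ : HeckeCharacter K) (M : ℕ) :
    HeckeCharacter.galConj σ ((HeckeCharacter.galConj σ Ψ * Ψ⁻¹) ^ M) *
      (HeckeCharacter.galConj σ Ψ * Ψ⁻¹) ^ M = 1 := by
  rw [galConj_pow', ← mul_pow, HeckeCharacter.galConj_mul, HeckeCharacter.galConj_inv,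
    galConj_galConj_of_mul_self_eq_one hσ]
  have h : Ψ * (HeckeCharacter.galConj σ Ψ)⁻¹ * (HeckeCharacter.galConj σ Ψ * Ψ⁻¹) = 1 := by
    rw [mul_assoc, inv_mul_cancel_left, mul_inv_cancel]
  rw [h, one_pow]

/-- Everywhere-unramifiedness of natural powers. [folklore] -/
theorem isUnramifiedAt_pow' {A : HeckeCharacter K} (hunr : ∀ w : HeightOneSpectrum (𝓞 K), A.IsUnramifiedAt w)
    (k : ℕ) (w : HeightOneSpectrum (𝓞 K)) : (A ^ (k + 1)).IsUnramifiedAt w := by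
  induction k with
  | zero => simpa using hunr w
  | succ k ih => rw [pow_succ']; exact (hunr w).mul' ih

/-- Infinity type of a natural power (parallel weights). [folklore] -/
theorem hasInfinityType_pow' {A : HeckeCharacter K} {a b : ℤ}
    (h : A.HasInfinityType (fun _ ↦ a) (fun _ ↦ b)) (k : ℕ) :
    (A ^ k).HasInfinityType (fun _ ↦ (k : ℤ) * a) (fun _ ↦ (k : ℤ) * b) := by
  have h' := h.zpow' (k : ℤ)
  rw [zpow_natCast] at h'
  convert h' using 2
  all_goals simp

end GalConjAlgebra

/-! ### §2. Imaginary quadratic bookkeeping: `c² = 1`, a `ρ ∉ res Γ_K`, `ρ̄ = c` -/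

section ImaginaryQuadratic

variable {K : Type} [Field K] [NumberField K]

/-- The complex conjugation of a CM field is an involution (Mathlib `IsCMField.complexConj_apply_apply`). [folklore] -/
theorem complexConj_mul_self [IsCMField K] : IsCMField.complexConj K * IsCMField.complexConj K = 1 := by
  ext x
  rw [AlgEquiv.mul_apply, IsCMField.complexConj_apply_apply, AlgEquiv.one_apply]

/-- For `K` imaginary quadratic there is `ρ ∈ Γ_ℚ` outside `res(Γ_K)` (a lift of the complex conjugation of `K`;
`absGaloisQuot_surjective`). Literature-only re-derivation of the Theorems-side lemma of the same name. [cite: Washington1997, §13.1] -/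
theorem exists_not_mem_range_absGaloisRestrict' [IsGalois ℚ K] (hK : IsImaginaryQuadratic K) :
    ∃ ρ : absoluteGaloisGroup ℚ, ρ ∉ Set.range (absGaloisRestrict ℚ K) := by
  haveI := IsImaginaryQuadratic.isCMField hK
  obtain ⟨ρ, hρ⟩ := absGaloisQuot_surjective ℚ K ((IsCMField.complexConj K).restrictScalars ℚ)
  refine ⟨ρ, fun hmem ↦ ?_⟩
  have h1 : absGaloisQuot ℚ K ρ = 1 := (absGaloisQuot_eq_one_iff ℚ K ρ).mpr hmem
  rw [hρ] at h1
  apply IsCMField.complexConj_ne_one K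
  ext x
  have := AlgEquiv.congr_fun h1 x
  simpa using this

/-- For `K` imaginary quadratic and `c ∉ res(Γ_K)`, `absGaloisQuot ℚ K c` is the complex conjugation of the CM field `K`
(both are the non-trivial element of the two-element group `Gal(K/ℚ)`). Literature-only re-derivation (as in
`SplitsliceSeams` S36) of the Theorems-side `UniversalToricDescentThinCombReflectedAvatar.absGaloisQuot_eq_complexConj`.
[cite: Washington1997, §13.1] -/
theorem absGaloisQuot_eq_complexConj' [IsGalois ℚ K] (hK : IsImaginaryQuadratic K) {c : absoluteGaloisGroup ℚ}
    (hc : c ∉ Set.range (absGaloisRestrict ℚ K)) :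
    haveI := IsImaginaryQuadratic.isCMField hK
    absGaloisQuot ℚ K c = (IsCMField.complexConj K).restrictScalars ℚ := by
  haveI := IsImaginaryQuadratic.isCMField hK
  have hcbar : absGaloisQuot ℚ K c ≠ 1 := fun h ↦ hc ((absGaloisQuot_eq_one_iff ℚ K c).mp h)
  have hσ : (IsCMField.complexConj K).restrictScalars ℚ ≠ 1 := by
    intro h
    apply IsCMField.complexConj_ne_one K
    ext x
    have := AlgEquiv.congr_fun h x
    simpa using this
  have hcard : Fintype.card (K ≃ₐ[ℚ] K) ≤ 2 := hK.1 ▸ AlgEquiv.card_le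
  by_contra hne
  have h3 : 2 < Fintype.card (K ≃ₐ[ℚ] K) := by
    rw [← Finset.card_univ]
    exact Finset.two_lt_card_iff.mpr ⟨1, absGaloisQuot ℚ K c, (IsCMField.complexConj K).restrictScalars ℚ,
      Finset.mem_univ _, Finset.mem_univ _, Finset.mem_univ _, hcbar.symm, hσ.symm, hne⟩
  omega

/-- `ψ ∘ c̄ = ψ ∘ (complex conjugation)` as Hecke characters (`K` imaginary quadratic, `c ∉ res(Γ_K)`); re-derivation of
the Theorems-side `galConj_absGaloisQuot_eq` (as in `SplitsliceSeams` S37). [cite: Washington1997, §13.1] -/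
theorem galConj_absGaloisQuot_eq' [IsGalois ℚ K] (hK : IsImaginaryQuadratic K) {c : absoluteGaloisGroup ℚ}
    (hc : c ∉ Set.range (absGaloisRestrict ℚ K)) (ψ : HeckeCharacter K) :
    haveI := IsImaginaryQuadratic.isCMField hK
    HeckeCharacter.galConj (absGaloisQuot ℚ K c) ψ = HeckeCharacter.galConj (IsCMField.complexConj K) ψ := by
  haveI := IsImaginaryQuadratic.isCMField hK
  rw [absGaloisQuot_eq_complexConj' hK hc, HeckeCharacter.galConj_restrictScalars]

end ImaginaryQuadratic

/-! ### §3. (I) THE TWO-CHARACTER SUPPLY — existence of the adapted datum with the Hecke identity -/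

section Supply

variable {K : Type} [Field K] [NumberField K] {p : ℕ} [Fact p.Prime]

/-- **(I) of annex g45 §9, in kernel.** For `K` imaginary quadratic, ANY prime `p`, `ι : ℚ̄_p ≃ ℂ` and ANY generator
pair `(κ₁, κ₂; γ₁, γ₂)` of `Γ_K`: there are everywhere-unramified Hecke characters `A` of infinity type `(−a₁, a₂)`,
`a₁ ≠ a₂`, and `B` of type `(−b₁, b₂)`, `b₁, b₂ ≥ 1`, with `p`-adic avatars `rA`, `rB` factoring through the pair, such
that `(B ∘ c)·B = 1` for the complex conjugation `c` of `K`. Witness: `Ψ` of type `(h_K w_K, 0)` from (r1);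
`A := (Ψ⁻¹)^{M_A}`, `B := ((Ψ ∘ c)·Ψ⁻¹)^{M_B}` with the torsion-killing exponents of (r2); so
`(a₁, a₂, b₁, b₂) = (M_A h_K w_K, 0, M_B h_K w_K, M_B h_K w_K)`.
[cite: deShalit1987, II.1.4 Lemma (ii); II.4.17 (54) (p. 78)] [cite: Weil1956, §1–§2] [cite: Washington1997, §13.1, Thm. 13.4] -/
theorem exists_adaptedPair (ι : PadicAlgCl p ≃+* ℂ) (hK : IsImaginaryQuadratic K)
    {κ₁ κ₂ : ZpExtension K p} {γ₁ γ₂ : absoluteGaloisGroup K}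
    (hγ : ZpExtension.IsTopGeneratorPair κ₁ κ₂ γ₁ γ₂) :
    haveI := IsImaginaryQuadratic.isCMField hK
    ∃ (A B : HeckeCharacter K) (rA rB : FramedGaloisRep K (PadicAlgCl p) 1) (a₁ a₂ b₁ b₂ : ℕ),
      IsPAdicAvatarOf ι A rA ∧ IsPAdicAvatarOf ι B rB ∧
      FactorsThroughPair κ₁ κ₂ rA ∧ FactorsThroughPair κ₁ κ₂ rB ∧
      (∀ w : HeightOneSpectrum (𝓞 K), A.IsUnramifiedAt w) ∧ (∀ w : HeightOneSpectrum (𝓞 K), B.IsUnramifiedAt w) ∧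
      a₁ ≠ a₂ ∧ 1 ≤ b₁ ∧ 1 ≤ b₂ ∧
      A.HasInfinityType (fun _ ↦ -(a₁ : ℤ)) (fun _ ↦ (a₂ : ℤ)) ∧
      B.HasInfinityType (fun _ ↦ -(b₁ : ℤ)) (fun _ ↦ (b₂ : ℤ)) ∧
      HeckeCharacter.galConj (IsCMField.complexConj K) B * B = 1 := by
  haveI := IsImaginaryQuadratic.isCMField hK
  haveI : IsTotallyComplex K := hK.2
  have himag : ∀ w : InfinitePlace K, w.IsComplex := IsTotallyComplex.isComplex
  have hcc : IsCMField.complexConj K * IsCMField.complexConj K = 1 := complexConj_mul_self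
  -- (r1): an everywhere-unramified `Ψ` of type `(N₀, 0)`, `N₀ = h_K w_K > 0`
  obtain ⟨Ψ, hΨt, hΨu⟩ :=
    HeckeCharacter.exists_hasInfinityType_classNumber_mul_torsionOrder_unramified (K := K) hK.1
  set N₀ : ℕ := Fintype.card (ClassGroup (𝓞 K)) * Units.torsionOrder K with hN₀
  have hN₀pos : 0 < N₀ := Nat.mul_pos Fintype.card_pos (Units.torsionOrder_pos K)
  -- `Ψ⁻¹`: type `(−N₀, 0)`, everywhere unramified, algebraic
  have hΨit : Ψ⁻¹.HasInfinityType (fun _ ↦ -(N₀ : ℤ)) (fun _ ↦ (0 : ℤ)) := by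
    convert hΨt.inv using 2
    all_goals simp
  have hΨiu : ∀ v : HeightOneSpectrum (𝓞 K), Ψ⁻¹.IsUnramifiedAt v := fun v ↦ (hΨu v).inv'
  have hΨia : Ψ⁻¹.IsAlgebraic := ⟨_, _, hΨit⟩
  -- `Φ := (Ψ ∘ c)·Ψ⁻¹`: type `(−N₀, N₀)`, everywhere unramified, algebraic
  set Φ : HeckeCharacter K := HeckeCharacter.galConj (IsCMField.complexConj K) Ψ * Ψ⁻¹ with hΦ
  have hΦt : Φ.HasInfinityType (fun _ ↦ -(N₀ : ℤ)) (fun _ ↦ (N₀ : ℤ)) := by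
    convert hΨt.galConj_complexConj.mul' hΨt.inv using 2
    all_goals simp
  have hΦu : ∀ v : HeightOneSpectrum (𝓞 K), Φ.IsUnramifiedAt v := fun v ↦
    ((HeckeCharacter.isUnramifiedAt_galConj_iff (IsCMField.complexConj K) Ψ v).2 (hΨu _)).mul' (hΨu v).inv'
  have hΦa : Φ.IsAlgebraic := ⟨_, _, hΦt⟩
  -- (r2), applied separately to `Ψ⁻¹` and to `Φ`
  obtain ⟨MA, χA, hMA, hA⟩ :=
    Theorems.CycTangentCMCycTangentBoundPairSupply.exists_isPAdicAvatarOf_pow_factorsThroughPair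
      ι hK.1 himag hΨia (fun v _ ↦ hΨiu v) hγ
  obtain ⟨MB, χB, hMB, hB⟩ :=
    Theorems.CycTangentCMCycTangentBoundPairSupply.exists_isPAdicAvatarOf_pow_factorsThroughPair
      ι hK.1 himag hΦa (fun v _ ↦ hΦu v) hγ
  obtain ⟨MA', rfl⟩ := Nat.exists_eq_succ_of_ne_zero hMA.ne'
  obtain ⟨MB', rfl⟩ := Nat.exists_eq_succ_of_ne_zero hMB.ne'
  have hA1 := hA 1
  have hB1 := hB 1
  simp only [mul_one, pow_one] at hA1 hB1
  obtain ⟨hrA, hκA⟩ := hA1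
  obtain ⟨hrB, hκB⟩ := hB1
  refine ⟨Ψ⁻¹ ^ (MA' + 1), Φ ^ (MB' + 1), _, _, (MA' + 1) * N₀, 0, (MB' + 1) * N₀, (MB' + 1) * N₀,
    hrA, hrB, hκA, hκB, isUnramifiedAt_pow' hΨiu MA', isUnramifiedAt_pow' hΦu MB',
    (Nat.mul_pos (Nat.succ_pos MA') hN₀pos).ne', Nat.mul_pos (Nat.succ_pos MB') hN₀pos,
    Nat.mul_pos (Nat.succ_pos MB') hN₀pos, ?_, ?_, galConj_mul_self_eq_one_of_witness hcc Ψ (MB' + 1)⟩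
  · convert hasInfinityType_pow' hΨit (MA' + 1) using 2
    all_goals (push_cast; ring)
  · convert hasInfinityType_pow' hΦt (MB' + 1) using 2
    all_goals (push_cast; ring)

/-- **(I) with the Hecke identity in `SplitsliceSeams` S42's exact shape** `galConj (absGaloisQuot ℚ K ρ) B * B = 1` for a
given `ρ ∈ Γ_ℚ ∖ res(Γ_K)` (`ρ̄ = c` by `galConj_absGaloisQuot_eq'`). The conjunct order is S42's / Fam decl 25's binder order:
`hrA hrB hκA hκB hunrA hunrB hab hb₁ hb₂ htA htB hBc`.
[cite: deShalit1987, II.1.4 Lemma (ii); II.4.17 (54) (p. 78)] [cite: Washington1997, §13.1, Thm. 13.4] -/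
theorem exists_adaptedPair_absGaloisQuot [IsGalois ℚ K] (ι : PadicAlgCl p ≃+* ℂ) (hK : IsImaginaryQuadratic K)
    {κ₁ κ₂ : ZpExtension K p} {γ₁ γ₂ : absoluteGaloisGroup K}
    (hγ : ZpExtension.IsTopGeneratorPair κ₁ κ₂ γ₁ γ₂)
    (ρ : absoluteGaloisGroup ℚ) (hρ : ρ ∉ Set.range (absGaloisRestrict ℚ K)) :
    ∃ (A B : HeckeCharacter K) (rA rB : FramedGaloisRep K (PadicAlgCl p) 1) (a₁ a₂ b₁ b₂ : ℕ),
      IsPAdicAvatarOf ι A rA ∧ IsPAdicAvatarOf ι B rB ∧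
      FactorsThroughPair κ₁ κ₂ rA ∧ FactorsThroughPair κ₁ κ₂ rB ∧
      (∀ w : HeightOneSpectrum (𝓞 K), A.IsUnramifiedAt w) ∧ (∀ w : HeightOneSpectrum (𝓞 K), B.IsUnramifiedAt w) ∧
      a₁ ≠ a₂ ∧ 1 ≤ b₁ ∧ 1 ≤ b₂ ∧
      A.HasInfinityType (fun _ ↦ -(a₁ : ℤ)) (fun _ ↦ (a₂ : ℤ)) ∧
      B.HasInfinityType (fun _ ↦ -(b₁ : ℤ)) (fun _ ↦ (b₂ : ℤ)) ∧
      HeckeCharacter.galConj (absGaloisQuot ℚ K ρ) B * B = 1 := by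
  obtain ⟨A, B, rA, rB, a₁, a₂, b₁, b₂, hrA, hrB, hκA, hκB, hunrA, hunrB, hab, hb₁, hb₂, htA, htB, hBc⟩ :=
    exists_adaptedPair ι hK hγ
  refine ⟨A, B, rA, rB, a₁, a₂, b₁, b₂, hrA, hrB, hκA, hκB, hunrA, hunrB, hab, hb₁, hb₂, htA, htB, ?_⟩
  rw [galConj_absGaloisQuot_eq' hK hρ]
  exact hBc

end Supply

/-! ### §4. Fibre supply: the CANONICAL coinvariant module along a ring map with a ring section

For the doors of `SplitsliceFam` §F9–§F12 (decls 9, 10, 12) the per-line module data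
`(F n, φ n, hφ n, hφk n)` — an `S`-module `F n`, a `θ_n`-SEMILINEAR SURJECTION `φ n : M →ₛₗ[θ_n] F n` from
`M = Λ^ur'_2 ⊗_{Λ₂} X_Gr,2` with `ker (φ n) ≤ (ker θ_n)·M` — are NOT arithmetic input: along any ring map
`θ : R →+* S` admitting a ring SECTION `ς` (for `θ_n = curveFam … n : W⟦T⟧⟦X⟧ → W⟦T⟧` the section is
`PowerSeries.C`, `curveFam n (C q) = q` = `SplitsliceFam.outerChar_C`) the coinvariant module
`M ⧸ (ker θ)·M` with the `ς`-structure and the quotient map supply them (`fibreMap`, `fibreMap_surjective`,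
`fibreMap_eq_zero_iff`), and ANY datum `(F, φ, hφ, hφk)` is canonically `S`-isomorphic to it
(`fibreEquivOfControl`) — so the arithmetic content of the doors' (iv) is EXACTLY the pair
(`hX` = CTRL_ℓ: a pseudo-isomorphism of this fibre with a module `X n`; `h`: `p^t · θ_n(g) ∈ char_S(X n)`),
equivalently the single membership `p^t · θ_n(g) ∈ char_S(M ⧸ (ker θ_n)·M)` (junction (J3), annex g46 §2). -/

section FibreSupply

variable {R S : Type*} [CommRing R] [CommRing S] (θ : R →+* S) (ς : S →+* R)
variable (M : Type*) [AddCommGroup M] [Module R M]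

/-- **The fibre of `M` along `θ`**: the coinvariant module `M ⧸ (ker θ)·M`. [folklore] -/
abbrev Fibre : Type _ := M ⧸ (RingHom.ker θ • (⊤ : Submodule R M))

/-- Its `S`-module structure through a ring SECTION `ς` of `θ` (`θ ∘ ς = id`): `s • [m] := [ς s • m]`
(the pattern of `SplitsliceCtrl.fibreModule` / `QtameDoor5.fibreModule`, the case `θ = ev₂ hu`,
`ς = fibreSection`). Not an instance: consumers say `letI := fibreModuleOfSection θ ς M`. [folklore] -/
abbrev fibreModuleOfSection : Module S (Fibre θ M) := Module.compHom _ ς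

variable {θ ς}

/-- `r − ς (θ r) ∈ ker θ` for a section `ς`. [folklore] -/
theorem sub_section_mem_ker (hς : ∀ s, θ (ς s) = s) (r : R) : r - ς (θ r) ∈ RingHom.ker θ := by
  rw [RingHom.mem_ker, map_sub, hς, sub_self]

/-- `[r • m] = [ς (θ r) • m]` in the fibre. [folklore] -/
theorem mk_smul_eq_mk_section_smul (hς : ∀ s, θ (ς s) = s) (r : R) (m : M) :
    (Submodule.Quotient.mk (r • m) : Fibre θ M) = Submodule.Quotient.mk (ς (θ r) • m) := by
  rw [Submodule.Quotient.eq, ← sub_smul]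
  exact Submodule.smul_mem_smul (sub_section_mem_ker hς r) Submodule.mem_top

variable (θ ς)

/-- A `θ`-semilinear map kills `(ker θ)·M` — automatically, since `θ (ker θ) = 0`. [folklore] -/
theorem map_eq_zero_of_mem_ker_smul_top {N : Type*} [AddCommGroup N] [Module S N] (Φ : M →ₛₗ[θ] N)
    {y : M} (hy : y ∈ RingHom.ker θ • (⊤ : Submodule R M)) : Φ y = 0 := by
  refine Submodule.smul_induction_on hy (fun r hr n _ => ?_) (fun x y hx hy => ?_)
  · rw [LinearMap.map_smulₛₗ, RingHom.mem_ker.mp hr, zero_smul]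
  · rw [map_add, hx, hy, add_zero]

/-- **The fibre map** `M → M ⧸ (ker θ)·M`, `θ`-SEMILINEAR for the `ς`-structure. [folklore] -/
def fibreMap (hς : ∀ s, θ (ς s) = s) :
    letI := fibreModuleOfSection θ ς M
    M →ₛₗ[θ] Fibre θ M :=
  letI := fibreModuleOfSection θ ς M
  { toFun := Submodule.Quotient.mk
    map_add' := fun _ _ => rfl
    map_smul' := fun r m => by
      rw [mk_smul_eq_mk_section_smul M hς r m]
      rfl }

theorem fibreMap_apply (hς : ∀ s, θ (ς s) = s) (m : M) :
    fibreMap θ ς M hς m = Submodule.Quotient.mk m := rfl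

/-- The fibre map is ONTO (the doors' `hφ`). [folklore] -/
theorem fibreMap_surjective (hς : ∀ s, θ (ς s) = s) : Function.Surjective (fibreMap θ ς M hς) :=
  Submodule.Quotient.mk_surjective _

/-- Its kernel is EXACTLY `(ker θ)·M`. [folklore] -/
theorem fibreMap_eq_zero_iff (hς : ∀ s, θ (ς s) = s) (y : M) :
    fibreMap θ ς M hς y = 0 ↔ y ∈ RingHom.ker θ • (⊤ : Submodule R M) := by
  rw [fibreMap_apply, Submodule.Quotient.mk_eq_zero]

/-- The kernel condition in the shape of the doors' `hφk` binders. [folklore] -/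
theorem mem_ker_smul_top_of_fibreMap_eq_zero (hς : ∀ s, θ (ς s) = s) (y : M)
    (hy : fibreMap θ ς M hς y = 0) : y ∈ RingHom.ker θ • (⊤ : Submodule R M) :=
  (fibreMap_eq_zero_iff θ ς M hς y).mp hy

/-- **Universal property, map.** The descent of a `θ`-semilinear `Φ : M → N` to an `S`-LINEAR map on the
fibre (for the `ς`-structure): `[m] ↦ Φ m`. [folklore] -/
def fibreLift {N : Type*} [AddCommGroup N] [Module S N] (hς : ∀ s, θ (ς s) = s) (Φ : M →ₛₗ[θ] N) :
    letI := fibreModuleOfSection θ ς M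
    Fibre θ M →ₗ[S] N :=
  letI := fibreModuleOfSection θ ς M
  letI : Module R N := Module.compHom N θ
  let Φ' : M →ₗ[R] N :=
    { toFun := Φ
      map_add' := Φ.map_add
      map_smul' := fun r m => by rw [LinearMap.map_smulₛₗ]; rfl }
  let L : Fibre θ M →ₗ[R] N :=
    (RingHom.ker θ • (⊤ : Submodule R M)).liftQ Φ'
      (fun y hy => LinearMap.mem_ker.mpr (map_eq_zero_of_mem_ker_smul_top θ M Φ hy))
  { toFun := L
    map_add' := L.map_add
    map_smul' := fun s q => by
      change L (ς s • q) = s • L q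
      rw [L.map_smul]
      change θ (ς s) • L q = s • L q
      rw [hς] }

theorem fibreLift_mk {N : Type*} [AddCommGroup N] [Module S N] (hς : ∀ s, θ (ς s) = s)
    (Φ : M →ₛₗ[θ] N) (m : M) :
    fibreLift θ ς M hς Φ (Submodule.Quotient.mk m) = Φ m := rfl

/-- `fibreLift Φ ∘ fibreMap = Φ`. [folklore] -/
theorem fibreLift_fibreMap {N : Type*} [AddCommGroup N] [Module S N] (hς : ∀ s, θ (ς s) = s)
    (Φ : M →ₛₗ[θ] N) (m : M) : fibreLift θ ς M hς Φ (fibreMap θ ς M hς m) = Φ m := rfl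

/-- `fibreLift Φ` is onto when `Φ` is. [folklore] -/
theorem fibreLift_surjective {N : Type*} [AddCommGroup N] [Module S N] (hς : ∀ s, θ (ς s) = s)
    (Φ : M →ₛₗ[θ] N) (hΦ : Function.Surjective Φ) : Function.Surjective (fibreLift θ ς M hς Φ) := by
  intro n
  obtain ⟨m, rfl⟩ := hΦ n
  exact ⟨Submodule.Quotient.mk m, rfl⟩

/-- `fibreLift Φ` is one-to-one when `ker Φ ≤ (ker θ)·M` (the doors' `hφk`). [folklore] -/
theorem fibreLift_injective {N : Type*} [AddCommGroup N] [Module S N] (hς : ∀ s, θ (ς s) = s)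
    (Φ : M →ₛₗ[θ] N) (hΦk : ∀ y, Φ y = 0 → y ∈ RingHom.ker θ • (⊤ : Submodule R M)) :
    Function.Injective (fibreLift θ ς M hς Φ) := by
  letI := fibreModuleOfSection θ ς M
  rw [injective_iff_map_eq_zero]
  intro q hq
  induction q using Submodule.Quotient.induction_on with
  | H m => exact (Submodule.Quotient.mk_eq_zero _).mpr (hΦk m hq)

/-- **Universal property, equivalence: ANY control datum `(N, Φ, hΦ, hΦk)` of the doors' shape IS the canonical
fibre** — `M ⧸ (ker θ)·M ≃ₗ[S] N`, `[m] ↦ Φ m`. So the binders `(F n, φ n, hφ n, hφk n)` of `SplitsliceFam`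
decls 9/10/12 carry no information beyond `M` and `θ_n`. [folklore] -/
noncomputable def fibreEquivOfControl {N : Type*} [AddCommGroup N] [Module S N] (hς : ∀ s, θ (ς s) = s)
    (Φ : M →ₛₗ[θ] N) (hΦ : Function.Surjective Φ)
    (hΦk : ∀ y, Φ y = 0 → y ∈ RingHom.ker θ • (⊤ : Submodule R M)) :
    letI := fibreModuleOfSection θ ς M
    Fibre θ M ≃ₗ[S] N :=
  letI := fibreModuleOfSection θ ς M
  LinearEquiv.ofBijective (fibreLift θ ς M hς Φ)
    ⟨fibreLift_injective θ ς M hς Φ hΦk, fibreLift_surjective θ ς M hς Φ hΦ⟩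

theorem fibreEquivOfControl_mk {N : Type*} [AddCommGroup N] [Module S N] (hς : ∀ s, θ (ς s) = s)
    (Φ : M →ₛₗ[θ] N) (hΦ : Function.Surjective Φ)
    (hΦk : ∀ y, Φ y = 0 → y ∈ RingHom.ker θ • (⊤ : Submodule R M)) (m : M) :
    fibreEquivOfControl θ ς M hς Φ hΦ hΦk (Submodule.Quotient.mk m) = Φ m := rfl

/-- **The characteristic ideal of ANY door datum is that of the canonical fibre** (transport along
`fibreEquivOfControl` by the tree's `Module.charIdeal_eq_of_linearEquiv`). So a divisibility
`x ∈ char_S(N)` for some control datum `(N, Φ, hΦ, hΦk)` is the SAME statement as `x ∈ char_S(M ⧸ (ker θ)·M)`. [folklore] -/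
theorem charIdeal_fibre_eq_of_control {N : Type*} [AddCommGroup N] [Module S N] (hς : ∀ s, θ (ς s) = s)
    (Φ : M →ₛₗ[θ] N) (hΦ : Function.Surjective Φ)
    (hΦk : ∀ y, Φ y = 0 → y ∈ RingHom.ker θ • (⊤ : Submodule R M)) :
    letI := fibreModuleOfSection θ ς M
    Module.charIdeal S (Fibre θ M) = Module.charIdeal S N :=
  letI := fibreModuleOfSection θ ς M
  Module.charIdeal_eq_of_linearEquiv (fibreEquivOfControl θ ς M hς Φ hΦ hΦk)

/-- … in the membership shape of the doors' binder `h`. [folklore] -/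
theorem mem_charIdeal_fibre_iff_of_control {N : Type*} [AddCommGroup N] [Module S N] (hς : ∀ s, θ (ς s) = s)
    (Φ : M →ₛₗ[θ] N) (hΦ : Function.Surjective Φ)
    (hΦk : ∀ y, Φ y = 0 → y ∈ RingHom.ker θ • (⊤ : Submodule R M)) (x : S) :
    letI := fibreModuleOfSection θ ς M
    x ∈ Module.charIdeal S (Fibre θ M) ↔ x ∈ Module.charIdeal S N := by
  rw [charIdeal_fibre_eq_of_control θ ς M hς Φ hΦ hΦk]

/-- **A pseudo-isomorphism class of ANY door datum is that of the canonical fibre**: CTRL_ℓ stated for some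
control datum `N ∼ X` gives `M ⧸ (ker θ)·M ∼ X` (the doors' `hX` for `F := Fibre θ M`). [folklore] -/
theorem arePseudoIsomorphic_fibre_of_control {N X : Type*} [AddCommGroup N] [Module S N] [AddCommGroup X]
    [Module S X] (hς : ∀ s, θ (ς s) = s) (Φ : M →ₛₗ[θ] N) (hΦ : Function.Surjective Φ)
    (hΦk : ∀ y, Φ y = 0 → y ∈ RingHom.ker θ • (⊤ : Submodule R M)) (hX : Module.ArePseudoIsomorphic S N X) :
    letI := fibreModuleOfSection θ ς M
    Module.ArePseudoIsomorphic S (Fibre θ M) X :=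
  letI := fibreModuleOfSection θ ς M
  (Module.ArePseudoIsomorphic.of_linearEquiv (fibreEquivOfControl θ ς M hς Φ hΦ hΦk)).trans hX

end FibreSupply

/-! ### §5. Frame transport — the (vi-b) split (v1.3): `hG₀` from a rational member over the printed Katz
series and a transport series -/

section FrameTransport

variable {p : ℕ} [Fact p.Prime] {K : Type} [Field K] [NumberField K]

/-- `‖r(σ)² − 1‖ < 1` for `r` through the `ℤ_p²`-tower (`r² − 1 = (r − 1)·((r − 1) + 2)`; from the tree's
`norm_avatarValueAt_sub_one_lt_of_factorsThroughPair`; same text as `SplitsliceG3` S6, re-derived because a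
Cruxes workfile cannot import another). [cite: Washington1997, §13.1] -/
theorem norm_avatarValueAt_sq_sub_one_lt' {κ₁ κ₂ : ZpExtension K p} {r : FramedGaloisRep K (PadicAlgCl p) 1}
    (h : FactorsThroughPair κ₁ κ₂ r) (σ : absoluteGaloisGroup K) :
    ‖avatarValueAt r σ ^ 2 - 1‖ < 1 := by
  have h1 := norm_avatarValueAt_sub_one_lt_of_factorsThroughPair h σ
  have h2 : ‖avatarValueAt r σ - 1 + 2‖ ≤ 1 := by
    refine (IsUltrametricDist.norm_add_le_max _ _).trans (max_le h1.le ?_)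
    simpa using IsUltrametricDist.norm_natCast_le_one ℂ_[p] 2
  calc ‖avatarValueAt r σ ^ 2 - 1‖ = ‖(avatarValueAt r σ - 1) * (avatarValueAt r σ - 1 + 2)‖ := by ring_nf
    _ = ‖avatarValueAt r σ - 1‖ * ‖avatarValueAt r σ - 1 + 2‖ := norm_mul _ _
    _ < 1 := by
      calc ‖avatarValueAt r σ - 1‖ * ‖avatarValueAt r σ - 1 + 2‖ ≤ ‖avatarValueAt r σ - 1‖ * 1 :=
            mul_le_mul_of_nonneg_left h2 (norm_nonneg _)
        _ < 1 := by simpa using h1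

/-- **(J4) the transport junction.** Let `G₀` lie in the Greenberg value frame over a Katz series `LK₀`
((vi-b₁): in print `LK₀ = 𝓛_v(K)`, `G₀ = 𝓛_p^Gr(f/K)`, both `Λ^ur`-rational), and let the crux's Katz series `LK`
be related to `LK₀` on the line `T₁ = 0` by a TRANSPORT series `V` ((vi-b₂)): at every point `(x, a − 1)` of the
open bidisc `V` has a value `w` with `LK(0, a² − 1) = w · LK₀(0, a² − 1)`. Then `V · G₀` lies in the frame over
`LK`. Proof: the frame prescribes `h_K · y · ι⁻¹(…)` with `y` THE value of the Katz series at `(0, r(g₂)² − 1)`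
(unique); values exist on the open bidisc and are multiplicative; the points have norm `< 1`.
[cite: deShalit1987, II.4.17 (54)] [cite: BurungaleSkinnerTianWan2024, Thm. 4.19, §6.4 (arXiv:2409.01350v2) (the rational member, shape only)] -/
theorem isGreenbergLFunctionAnyRoot₂_mul_of_transport {ι : PadicAlgCl p ≃+* ℂ}
    {v vbar : HeightOneSpectrum (𝓞 K)} {κ₁ κ₂ : ZpExtension K p} {g₁ g₂ : absoluteGaloisGroup K} {N : ℕ}
    {f : CuspForm (CongruenceSubgroup.Gamma0 N) 2} {D : ℕ} [NeZero D] {hK : ℕ}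
    {LK₀ G₀ LK V : PowerSeries (PowerSeries (PadicComplexInt p))}
    (hG₀ : IsGreenbergLFunctionAnyRoot₂ ι v vbar κ₁ κ₂ g₁ g₂ f D hK LK₀ G₀)
    (hVT : ∀ x a y₀ : ℂ_[p], ‖x‖ < 1 → ‖a - 1‖ < 1 → IntSeries.HasValueAt₂ LK₀ 0 (a ^ 2 - 1) y₀ →
      ∃ w : ℂ_[p], IntSeries.HasValueAt₂ V x (a - 1) w ∧ IntSeries.HasValueAt₂ LK 0 (a ^ 2 - 1) (w * y₀)) :
    IsGreenbergLFunctionAnyRoot₂ ι v vbar κ₁ κ₂ g₁ g₂ f D hK LK (V * G₀) := by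
  intro ξ r m n α hr hκ hunr hinf hα θ hθ L hL hL' y hy
  have hn₁ : ‖avatarValueAt r g₁ - 1‖ < 1 := norm_avatarValueAt_sub_one_lt_of_factorsThroughPair hκ g₁
  have hn₂ : ‖avatarValueAt r g₂ - 1‖ < 1 := norm_avatarValueAt_sub_one_lt_of_factorsThroughPair hκ g₂
  have hsq : ‖avatarValueAt r g₂ ^ 2 - 1‖ < 1 := norm_avatarValueAt_sq_sub_one_lt' hκ g₂
  -- THE value `y₀` of `LK₀` at `(0, r(g₂)² − 1)`
  obtain ⟨y₀, hy₀⟩ :=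
    Summit.BirchSwinnertonDyer.BirchSwinnertonDyer.Theorems.PrintCf2.KatzMeasureValue.exists_hasValueAt₂_of_norm_lt_one
      LK₀ (x := 0) (y := avatarValueAt r g₂ ^ 2 - 1) (by simp) hsq
  -- transport: `V(pt) = w`, `LK(0, r(g₂)² − 1) = w · y₀`, hence `y = w · y₀`
  obtain ⟨w, hw, hLK⟩ := hVT (avatarValueAt r g₁ - 1) (avatarValueAt r g₂) y₀ hn₁ hn₂ hy₀
  have hyw : y = w * y₀ := hy.unique hLK
  -- the printed member's value and the product rule
  have hG₀v := hG₀ ξ r m n α hr hκ hunr hinf hα θ hθ L hL hL' y₀ hy₀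
  have hmul :=
    Summit.BirchSwinnertonDyer.BirchSwinnertonDyer.Theorems.PrintCf2.RubinValueTwoReadout.hasValueAt₂_mul
      hn₁ hn₂ hw hG₀v
  convert hmul using 1
  rw [hyw]
  ring

/-- **(J4′) the door binder `hG₀` from (vi-b₁) + (vi-b₂)**: `V * map (map J₀) g` is a member of the crux's frame
over `LK` — verbatim the hypothesis `hG₀` of `SplitsliceFam` decl 12 with `u := V` (its `hu : IsUnit V` is the unit
clause of (vi-b₂)). [cite: deShalit1987, II.4.17 (54)] [cite: BurungaleSkinnerTianWan2024, Thm. 4.19, §6.4 (arXiv:2409.01350v2) (shape only)] -/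
theorem hG₀_of_rational_member_of_transport {ι : PadicAlgCl p ≃+* ℂ}
    {v vbar : HeightOneSpectrum (𝓞 K)} {κ₁ κ₂ : ZpExtension K p} {g₁ g₂ : absoluteGaloisGroup K} {N : ℕ}
    {f : CuspForm (CongruenceSubgroup.Gamma0 N) 2} {D : ℕ} [NeZero D] {hK : ℕ}
    {LK₀ LK V : PowerSeries (PowerSeries (PadicComplexInt p))}
    (J₀ : unrIntegers p →+* PadicComplexInt p) {g : PowerSeries (PowerSeries (unrIntegers p))}
    (hG₀ : IsGreenbergLFunctionAnyRoot₂ ι v vbar κ₁ κ₂ g₁ g₂ f D hK LK₀ (PowerSeries.map (PowerSeries.map J₀) g))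
    (hVT : ∀ x a y₀ : ℂ_[p], ‖x‖ < 1 → ‖a - 1‖ < 1 → IntSeries.HasValueAt₂ LK₀ 0 (a ^ 2 - 1) y₀ →
      ∃ w : ℂ_[p], IntSeries.HasValueAt₂ V x (a - 1) w ∧ IntSeries.HasValueAt₂ LK 0 (a ^ 2 - 1) (w * y₀)) :
    IsGreenbergLFunctionAnyRoot₂ ι v vbar κ₁ κ₂ g₁ g₂ f D hK LK (V * PowerSeries.map (PowerSeries.map J₀) g) :=
  isGreenbergLFunctionAnyRoot₂_mul_of_transport hG₀ hVT

/-- The constant series `1` has value `1` everywhere on the bidisc. [cite: deShalit1987, II.4.17 (54)] -/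
theorem hasValueAt₂_one' (x y : ℂ_[p]) :
    IntSeries.HasValueAt₂ (1 : PowerSeries (PowerSeries (PadicComplexInt p))) x y 1 := by
  unfold IntSeries.HasValueAt₂
  have h := hasSum_single (f := fun k : ℕ × ℕ ↦
      ((PowerSeries.coeff k.2 (PowerSeries.coeff k.1 (1 : PowerSeries (PowerSeries (PadicComplexInt p)))) :
          PadicComplexInt p) : ℂ_[p]) * x ^ k.1 * y ^ k.2) ((0 : ℕ), (0 : ℕ)) ?_
  · simpa using h
  · rintro ⟨i, j⟩ hij
    rcases i with _ | i
    · rcases j with _ | j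
      · exact absurd rfl hij
      · simp [PowerSeries.coeff_one]
    · simp [PowerSeries.coeff_one]

/-- **(vi-b₂♮) ⇒ (vi-b₂) with `V = 1`**: if the crux's Katz series IS the printed one (KATZ RIGIDITY across period
data, annex g46 §7: this seat's claim with proof sketch, not in print), the transport datum holds with `V = 1`,
`w = 1`, and the doors run with `u = 1`. [cite: deShalit1987, II.4.17 (54)] -/
theorem transport_one_of_eq {LK₀ LK : PowerSeries (PowerSeries (PadicComplexInt p))} (h : LK = LK₀) :
    ∀ x a y₀ : ℂ_[p], ‖x‖ < 1 → ‖a - 1‖ < 1 → IntSeries.HasValueAt₂ LK₀ 0 (a ^ 2 - 1) y₀ →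
      ∃ w : ℂ_[p], IntSeries.HasValueAt₂ (1 : PowerSeries (PowerSeries (PadicComplexInt p))) x (a - 1) w ∧
        IntSeries.HasValueAt₂ LK 0 (a ^ 2 - 1) (w * y₀) :=
  fun x a y₀ _ _ hy₀ => ⟨1, hasValueAt₂_one' x (a - 1), by simpa [h] using hy₀⟩

/-- … and then the rational member itself lies in the crux's frame (the doors with `u = 1`). [cite: deShalit1987, II.4.17 (54)] -/
theorem isGreenbergLFunctionAnyRoot₂_of_katz_eq {ι : PadicAlgCl p ≃+* ℂ}
    {v vbar : HeightOneSpectrum (𝓞 K)} {κ₁ κ₂ : ZpExtension K p} {g₁ g₂ : absoluteGaloisGroup K} {N : ℕ}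
    {f : CuspForm (CongruenceSubgroup.Gamma0 N) 2} {D : ℕ} [NeZero D] {hK : ℕ}
    {LK₀ G₀ LK : PowerSeries (PowerSeries (PadicComplexInt p))} (h : LK = LK₀)
    (hG₀ : IsGreenbergLFunctionAnyRoot₂ ι v vbar κ₁ κ₂ g₁ g₂ f D hK LK₀ G₀) :
    IsGreenbergLFunctionAnyRoot₂ ι v vbar κ₁ κ₂ g₁ g₂ f D hK LK (1 * G₀) :=
  isGreenbergLFunctionAnyRoot₂_mul_of_transport hG₀ (transport_one_of_eq h)

end FrameTransport

/-! ### §6. Period transport — (vi-b₂♭) DISCHARGED by the tree's two-variable Katz period rigidity (v1.4) -/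

section PeriodTransport

variable {p : ℕ} [Fact p.Prime] {K : Type} [Field K] [NumberField K]

/-- `‖a² − 1‖ < 1` for `‖a − 1‖ < 1` (`a² − 1 = (a − 1)(a − 1 + 2)`). [cite: Washington1997, §13.1] -/
theorem norm_sq_sub_one_lt_of_norm_sub_one_lt {a : ℂ_[p]} (h1 : ‖a - 1‖ < 1) : ‖a ^ 2 - 1‖ < 1 := by
  have h2 : ‖a - 1 + 2‖ ≤ 1 := by
    refine (IsUltrametricDist.norm_add_le_max _ _).trans (max_le h1.le ?_)
    simpa using IsUltrametricDist.norm_natCast_le_one ℂ_[p] 2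
  calc ‖a ^ 2 - 1‖ = ‖(a - 1) * (a - 1 + 2)‖ := by ring_nf
    _ = ‖a - 1‖ * ‖a - 1 + 2‖ := norm_mul _ _
    _ < 1 := by
      calc ‖a - 1‖ * ‖a - 1 + 2‖ ≤ ‖a - 1‖ * 1 := mul_le_mul_of_nonneg_left h2 (norm_nonneg _)
        _ < 1 := by simpa using h1

/-- The constant series `C (C c)` has value `c` everywhere on the bidisc. [cite: deShalit1987, II.4.17 (54)] -/
theorem hasValueAt₂_C_C (c : PadicComplexInt p) (x y : ℂ_[p]) :
    IntSeries.HasValueAt₂ (PowerSeries.C (PowerSeries.C c)) x y (c : ℂ_[p]) := by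
  unfold IntSeries.HasValueAt₂
  have h := hasSum_single (f := fun k : ℕ × ℕ ↦
      ((PowerSeries.coeff k.2 (PowerSeries.coeff k.1 (PowerSeries.C (PowerSeries.C c))) :
          PadicComplexInt p) : ℂ_[p]) * x ^ k.1 * y ^ k.2) ((0 : ℕ), (0 : ℕ)) ?_
  · simpa using h
  · rintro ⟨i, j⟩ hij
    rcases i with _ | i
    · rcases j with _ | j
      · exact absurd rfl hij
      · simp
    · simp

/-- Value of an INNER one-variable series `C Q` on the bidisc: `(C Q)(x, y) = Q(y)`. [cite: deShalit1987, II.4.17 (54)] -/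
theorem hasValueAt₂_C_of_hasValueAt {Q : PowerSeries (PadicComplexInt p)} {x y w : ℂ_[p]}
    (h : IntSeries.HasValueAt Q y w) : IntSeries.HasValueAt₂ (PowerSeries.C Q) x y w := by
  unfold IntSeries.HasValueAt₂
  unfold IntSeries.HasValueAt at h
  have hinj : Function.Injective (fun j : ℕ ↦ ((0 : ℕ), j)) := fun a b hab ↦ by
    simpa using congrArg Prod.snd hab
  rw [← hinj.hasSum_iff]
  · refine (Iff.of_eq (congrArg (fun f ↦ HasSum f w) ?_)).mpr h
    funext j
    simp [Function.comp, PowerSeries.coeff_C]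
  · rintro ⟨i, j⟩ hij
    rcases i with _ | i
    · exact absurd ⟨j, rfl⟩ hij
    · simp

/-- Value of an OUTER one-variable series `map C F` on the bidisc: `(map C F)(x, y) = F(x)`. [cite: deShalit1987, II.4.17 (54)] -/
theorem hasValueAt₂_map_C_of_hasValueAt {F : PowerSeries (PadicComplexInt p)} {x y u : ℂ_[p]}
    (h : IntSeries.HasValueAt F x u) :
    IntSeries.HasValueAt₂ (PowerSeries.map (PowerSeries.C (R := PadicComplexInt p)) F) x y u := by
  unfold IntSeries.HasValueAt₂
  unfold IntSeries.HasValueAt at h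
  have hinj : Function.Injective (fun i : ℕ ↦ (i, (0 : ℕ))) := fun a b hab ↦ by
    simpa using congrArg Prod.fst hab
  rw [← hinj.hasSum_iff]
  · refine (Iff.of_eq (congrArg (fun f ↦ HasSum f u) ?_)).mpr h
    funext i
    simp [Function.comp, PowerSeries.coeff_map, PowerSeries.coeff_C]
  · rintro ⟨i, j⟩ hij
    rcases j with _ | j
    · exact absurd ⟨i, rfl⟩ hij
    · simp [PowerSeries.coeff_map]

/-- The trivial Hecke character has infinity type `(−0, 0)` (B18's list with `a = b = 0`). [folklore] -/
theorem hasInfinityType_one_zero_zero :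
    (1 : HeckeCharacter K).HasInfinityType (fun _ ↦ -((0 : ℕ) : ℤ)) (fun _ ↦ ((0 : ℕ) : ℤ)) :=
  ⟨Set.univ, Filter.univ_mem, fun x _ ↦ by simp [HeckeCharacter.archFactor_apply]⟩

/-- The trivial Hecke character is unramified everywhere. [folklore] -/
theorem isUnramifiedAt_one' (w : HeightOneSpectrum (𝓞 K)) : (1 : HeckeCharacter K).IsUnramifiedAt w :=
  fun _ ↦ rfl

/-- **(J6) (vi-b₂♭) FROM THE TREE'S TWO-VARIABLE KATZ PERIOD RIGIDITY.** For `K` imaginary quadratic, `p = v v̄`,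
`ι ↔ v`, a topological generator pair `(κ₁, κ₂; γ₁, γ₂)`: if the crux's Katz series `LK` solves de Shalit's frame
(`S = ∅`, `λ = 1`, read at `(γ₁⁻¹, γ₂⁻¹)`) at period data `(Ω, δ, Ω_p)` and a series `LK₀ ≠ 0` (in print: Katz's
`Λ^ur`-rational measure) solves the SAME frame at `(Ω₀, δ₀, Ω_{p,0})` (six non-zero quantities), then by
`PrintCf2.KatzPeriodRigidity.exists_eq_unit_binomPow₂_mul` (`a = b = 0`, so its constant `C₀ = A⁰B⁰`)
`LK = c₀·(1+T₁)^x(1+T₂)^w·LK₀`, and the unit `V := c₀·(1+T₂)^{w}·(1+T₂)^{w}` (an inner one-variable series) is a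
TRANSPORT series in the sense of (J4): `LK(0, a² − 1) = V(x', a − 1)·LK₀(0, a² − 1)` on the open bidisc
(`((1+y)(1+y))^w = (1+y)^w(1+y)^w`, `onePlusPow_mul_base`). So the door binder pair `(hV, hVT)` of (J5) is
DISCHARGED from two inhabited Katz frames + `LK₀ ≠ 0`.
[cite: deShalit1987, II.4.12 Remarks (iii)–(iv) (p. 66–67), II.4.17 (52)–(54) (p. 77–78)] -/
theorem exists_transport_of_isKatzMeasure₂ (hK : IsImaginaryQuadratic K)
    {ι : PadicAlgCl p ≃+* ℂ} {v vbar : HeightOneSpectrum (𝓞 K)}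
    (hv : ((p : ℕ) : 𝓞 K) ∈ v.asIdeal) (hvbar : ((p : ℕ) : 𝓞 K) ∈ vbar.asIdeal) (hne : vbar ≠ v)
    (hι : ∀ (w : InfinitePlace K) (d : 𝓞 K), d ∈ v.asIdeal ↔ ‖ι.symm (w.embedding (d : K))‖ < 1)
    {κ₁ κ₂ : ZpExtension K p} {γ₁ γ₂ : absoluteGaloisGroup K}
    (hpair : ZpExtension.IsTopGeneratorPair κ₁ κ₂ γ₁ γ₂)
    {Ω δ Ω₀ δ₀ : ℂ} {Ωp Ωp₀ : ℂ_[p]} {LK LK₀ : PowerSeries (PowerSeries (PadicComplexInt p))}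
    (hLK : IsKatzMeasure₂ ι v vbar ∅ κ₁ κ₂ γ₁⁻¹ γ₂⁻¹ 1 Ω δ Ωp LK)
    (hLK₀ : IsKatzMeasure₂ ι v vbar ∅ κ₁ κ₂ γ₁⁻¹ γ₂⁻¹ 1 Ω₀ δ₀ Ωp₀ LK₀)
    (hΩ : Ω ≠ 0) (hδ : δ ≠ 0) (hΩp : Ωp ≠ 0) (hΩ₀ : Ω₀ ≠ 0) (hδ₀ : δ₀ ≠ 0) (hΩp₀ : Ωp₀ ≠ 0)
    (h0 : LK₀ ≠ 0) :
    ∃ V : PowerSeries (PowerSeries (PadicComplexInt p)), IsUnit V ∧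
      ∀ x a y₀ : ℂ_[p], ‖x‖ < 1 → ‖a - 1‖ < 1 → IntSeries.HasValueAt₂ LK₀ 0 (a ^ 2 - 1) y₀ →
        ∃ w : ℂ_[p], IntSeries.HasValueAt₂ V x (a - 1) w ∧ IntSeries.HasValueAt₂ LK 0 (a ^ 2 - 1) (w * y₀) := by
  -- the any-class-number seed of type `(w₀, 0)`
  haveI : IsTotallyComplex K := hK.2
  obtain ⟨w₀, η₀, hw₀, hη₀, -⟩ :=
    Literature.NumberTheory.GaloisRepresentations.HeckeCharacter.exists_hasInfinityType_pos_zero_unramified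
      (K := K) hK.1
  -- read the frames at the generator pair `(κᵢ.unitTwist (−1); γᵢ⁻¹)`
  have hpair' := Summit.BirchSwinnertonDyer.BirchSwinnertonDyer.Theorems.PrintCf2.KatzUniqueTransport.isTopGeneratorPair_neg_inv
    hpair
  have hLK' := (Summit.BirchSwinnertonDyer.BirchSwinnertonDyer.Theorems.PrintCf2.KatzUniqueTransport.isKatzMeasure₂_unitTwist_iff
    κ₁ κ₂ (-1) (-1) (γ₁ := γ₁⁻¹) (γ₂ := γ₂⁻¹) (lam := (1 : HeckeCharacter K)) (ι := ι) (v := v) (vbar := vbar)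
    (S := ∅) (Ω := Ω) (δ := δ) (Ωp := Ωp) (G := LK)).mpr hLK
  have hLK₀' := (Summit.BirchSwinnertonDyer.BirchSwinnertonDyer.Theorems.PrintCf2.KatzUniqueTransport.isKatzMeasure₂_unitTwist_iff
    κ₁ κ₂ (-1) (-1) (γ₁ := γ₁⁻¹) (γ₂ := γ₂⁻¹) (lam := (1 : HeckeCharacter K)) (ι := ι) (v := v) (vbar := vbar)
    (S := ∅) (Ω := Ω₀) (δ := δ₀) (Ωp := Ωp₀) (G := LK₀)).mpr hLK₀
  -- the tree's full period rigidity with `a = b = 0`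
  obtain ⟨c₀, x, w, hc₀, -, hEq⟩ :=
    Summit.BirchSwinnertonDyer.BirchSwinnertonDyer.Theorems.PrintCf2.KatzPeriodRigidity.exists_eq_unit_binomPow₂_mul
      hK hv hvbar hne hι (S := ∅) hw₀ hη₀ (a := 0) (b := 0) le_rfl hasInfinityType_one_zero_zero
      (fun w' _ _ ↦ isUnramifiedAt_one' w') hpair' hLK₀' hLK' hΩ₀ hδ₀ hΩp₀ hΩ hδ hΩp h0
  -- the transport series
  refine ⟨PowerSeries.C (PowerSeries.C c₀ * (IntSeries.binomPow w * IntSeries.binomPow w)), ?_, ?_⟩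
  · exact ((hc₀.map PowerSeries.C).mul ((IntSeries.isUnit_binomPow w).mul (IntSeries.isUnit_binomPow w))).map _
  intro x' a y₀ hx' ha hy₀
  have hsq : ‖a ^ 2 - 1‖ < 1 := norm_sq_sub_one_lt_of_norm_sub_one_lt ha
  refine ⟨(c₀ : ℂ_[p]) * (IntSeries.onePlusPow w (a - 1) * IntSeries.onePlusPow w (a - 1)), ?_, ?_⟩
  · refine hasValueAt₂_C_of_hasValueAt ?_
    have h1 := IntSeries.hasValueAt_C_mul_binomPow c₀ w ha
    have h2 := IntSeries.hasValueAt_binomPow w ha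
    have h12 := IntSeries.HasValueAt.mul ha h1 h2
    convert h12 using 1
    · ring
    · ring
  · -- the value of `c₀·(1+T₁)^x(1+T₂)^w·LK₀` at `(0, a² − 1)`
    rw [hEq]
    have hz : ‖(0 : ℂ_[p])‖ < 1 := by simp
    have hc : IntSeries.HasValueAt₂ (PowerSeries.C (PowerSeries.C c₀)) 0 (a ^ 2 - 1) (c₀ : ℂ_[p]) :=
      hasValueAt₂_C_C c₀ 0 (a ^ 2 - 1)
    have hx : IntSeries.HasValueAt₂ (PowerSeries.map (PowerSeries.C (R := PadicComplexInt p)) (IntSeries.binomPow x))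
        0 (a ^ 2 - 1) (IntSeries.onePlusPow x 0) :=
      hasValueAt₂_map_C_of_hasValueAt (IntSeries.hasValueAt_binomPow x hz)
    have hw : IntSeries.HasValueAt₂ (PowerSeries.C (IntSeries.binomPow w)) 0 (a ^ 2 - 1)
        (IntSeries.onePlusPow w (a ^ 2 - 1)) :=
      hasValueAt₂_C_of_hasValueAt (IntSeries.hasValueAt_binomPow w hsq)
    have hxw := Summit.BirchSwinnertonDyer.BirchSwinnertonDyer.Theorems.PrintCf2.RubinValueTwoReadout.hasValueAt₂_mul hz hsq hx hw
    have hcxw := Summit.BirchSwinnertonDyer.BirchSwinnertonDyer.Theorems.PrintCf2.RubinValueTwoReadout.hasValueAt₂_mul hz hsq hc hxw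
    have hall := Summit.BirchSwinnertonDyer.BirchSwinnertonDyer.Theorems.PrintCf2.RubinValueTwoReadout.hasValueAt₂_mul hz hsq hcxw hy₀
    have hbase : IntSeries.onePlusPow w (a ^ 2 - 1) = IntSeries.onePlusPow w (a - 1) * IntSeries.onePlusPow w (a - 1) := by
      rw [← IntSeries.onePlusPow_mul_base w ha ha]
      ring_nf
    convert hall using 1
    rw [IntSeries.onePlusPow_at_zero, hbase]
    ring


end PeriodTransport

end Summit.BirchSwinnertonDyer.BirchSwinnertonDyer.Cruxes.TwoVariableEulerSystemDivisibility.SplitsliceSupply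

end
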